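import Mathlib
import HarnessLib
import Summits.Langlands.Langlands.Theses.StickelbergerDial
import Literature.NumberTheory.NumberFields.SplitPrimesDisjointnessAbsolute
import Literature.NumberTheory.GaloisRepresentations.ResidualHypothesesVSplit
import Literature.NumberTheory.GaloisRepresentations.ResidualRepRestrict
import Literature.NumberTheory.GaloisRepresentations.ResidualGaloisRepOpenKernel
import Literature.NumberTheory.GaloisRepresentations.ArtinRestriction
import Literature.NumberTheory.Automorphic.CaraianiNewtonResidualImageModularity

/-!
# Stub S2 of crux `stmt-Langlands-18025` (`StickelbergerDial.UnramifiedFermatWitness`, line `Sketch`):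
the residual bundle transports along `res_{K'/K}` for `K'` linearly disjoint from a control field

For a number field `K`, a prime `ℓ`, a framed `r : Γ_K → GL_n(ℚ̄_ℓ)` and a residual representation
`τ : Γ_K → GL_n(ℤ̄_ℓ/𝔪)` of `r` — absolutely irreducible, absolutely irreducible on
`H = Γ_{K(ζ_ℓ)}` with `τ(H)` enormous, scalar at some `σ ∉ H` — we produce the finite CONTROL
FIELD `L = K̄^N ⊆ K̄`, `N = ker τ ∩ H` (the extension of `K(ζ_ℓ)` cut out by `τ|_{Γ_{K(ζ_ℓ)}}`, as in
ACC+ §6.5.12; it is finite because `ker τ` is open, `FramedGaloisRep.isOpen_ker_of_isResidualRepOf`),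
and show that for every number field `K' ⊇ K` with `L ⊗_K K'` a field the whole residual bundle
passes to `τ' = τ ∘ res`, `res = absGaloisRestrict K K'`:

* `IsField (L ⊗_K K')` makes `L` and the copy `e(K') ⊆ K̄` of `K'` with `res(Γ_{K'}) = Gal(K̄/e(K'))`
  (`exists_mem_range_absGaloisRestrict_iff`) linearly disjoint (Mathlib
  `IntermediateField.LinearDisjoint.of_isField'`), so `e(K') ∩ L = K` and, by Krull's Galois
  correspondence (tree `fixingSubgroup_sup_eq_top_of_inf_fixedField_eq_bot`),
  `res(Γ_{K'}) · N = Γ_K` (`range_absGaloisRestrict_sup_eq_top_of_isField`);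
* whence (tree `forall_exists_mem_of_sup_ker_inf_eq_top`) `τ'(Γ_{K'}) = τ(Γ_K)`,
  `τ'(Γ_{K'(ζ_ℓ)}) = τ(Γ_{K(ζ_ℓ)})` (`Γ_{K'(ζ_ℓ)} = res⁻¹ Γ_{K(ζ_ℓ)}`,
  `mem_absGaloisGroupAdjoinRootsOfUnity_iff_absGaloisRestrict`) and every `σ ∈ Γ_K` has a
  representative `σ' ∈ Γ_{K'}` with `τ (res σ') = τ σ`, `σ' ∈ Γ_{K'(ζ_ℓ)} ↔ σ ∈ Γ_{K(ζ_ℓ)}`;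
* absolute irreducibility (of `τ'` and of `τ'|_{Γ_{K'(ζ_ℓ)}}`) and enormousness depend only on the
  image subgroup (tree `IsAbsIrreducible.of_range_le`); `τ'` absolutely irreducible is a residual
  representation of `r|_{Γ_{K'}}` (tree `FramedGaloisRep.isResidualRepOf_restrictField_of_isAbsIrreducible`).

Theorem-only file; everything is proved (axioms ⊆ {propext, Classical.choice, Quot.sound}).

References: [BarnetlambEtAl2014] T. Barnet-Lamb, T. Gee, D. Geraghty, R. Taylor, *Potential
automorphy and change of weight*, Ann. of Math. 179 (2014), §4.5 (role of `F^{avoid}`);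
[ACCGHLNSTT2023] P. B. Allen et al., *Potential automorphy over CM fields*, Ann. of Math. 197
(2023), §6.5.12 (proof of Thm. 6.1.1); [NeukirchANT1999] J. Neukirch, *Algebraic Number Theory*,
Ch. IV §1 Thm. (1.2).
-/

set_option linter.dupNamespace false

noncomputable section

namespace Summit.Langlands.Langlands.Theorems.UnramifiedFermatWitness

open Literature.NumberTheory.GaloisRepresentations Literature.NumberTheory.NumberFields Field
open scoped MatrixGroups TensorProduct

/-! ### Linear disjointness from `K̄^N` forces `res(Γ_{K'}) · N = Γ_K` -/

/-- **`K̄^N ⊗_K K'` a field ⟹ `res(Γ_{K'}) · N = Γ_K`.**  For ANY subgroup `N ≤ Γ_K` of the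
absolute Galois group of a number field `K`, with fixed field `K̄^N ⊆ K̄`, and a finite extension
`K'/K` given as a `K`-algebra: if `K̄^N ⊗_K K'` is a field then the image of the restriction
`res = absGaloisRestrict K K' : Γ_{K'} → Γ_K` satisfies `res(Γ_{K'}) ⊔ N = ⊤`.  Indeed
`res(Γ_{K'}) = Gal(K̄/e(K'))` for a `K`-embedding `e : K' → K̄`
(`exists_mem_range_absGaloisRestrict_iff`); `K̄^N` and `e(K')` are linearly disjoint (Mathlib
`IntermediateField.LinearDisjoint.of_isField'`), so `e(K') ∩ K̄^N = K`, and Krull's Galois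
correspondence (`Gal(K̄/e(K')) · N` is open, with fixed field inside `e(K') ∩ K̄^N`) gives
`Gal(K̄/e(K')) · N = Γ_K` (tree `fixingSubgroup_sup_eq_top_of_inf_fixedField_eq_bot`).
[cite: NeukirchANT1999, Ch. IV §1 Thm. (1.2)] -/
theorem range_absGaloisRestrict_sup_eq_top_of_isField {K : Type} [Field K] [NumberField K]
    (N : Subgroup (absoluteGaloisGroup K)) (K' : Type) [Field K'] [Algebra K K']
    [FiniteDimensional K K']
    (h : IsField (TensorProduct K
      (IntermediateField.fixedField N : IntermediateField K (AlgebraicClosure K)) K')) :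
    ((absGaloisRestrict K K').range : Subgroup (absoluteGaloisGroup K)) ⊔ N = ⊤ := by
  set L₀ : IntermediateField K (AlgebraicClosure K) := IntermediateField.fixedField N with hL₀
  -- `res(Γ_{K'}) = Gal(K̄/E')` for the copy `E' = e(K') ⊆ K̄` of `K'`
  obtain ⟨e, he⟩ := exists_mem_range_absGaloisRestrict_iff K K'
  set E' : IntermediateField K (AlgebraicClosure K) := e.fieldRange with hE'
  have eE : K' ≃ₐ[K] E' := e.equivFieldRange
  have hrange : ((absGaloisRestrict K K').range : Subgroup (absoluteGaloisGroup K)) =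
      (E'.fixingSubgroup : Subgroup (absoluteGaloisGroup K)) := by
    ext g
    refine (he g).trans (Iff.trans ?_ (mem_fixingSubgroup_iff_forall_smul E' g).symm)
    constructor
    · rintro h' ⟨x, ⟨k, rfl⟩⟩
      exact h' k
    · intro h' k
      exact h' ⟨e k, ⟨k, rfl⟩⟩
  haveI : FiniteDimensional K E' := LinearEquiv.finiteDimensional eE.toLinearEquiv
  -- linear disjointness: `E' ∩ K̄^N = K`
  have hdisj : E' ⊓ L₀ = ⊥ := by
    have h1 := (IntermediateField.LinearDisjoint.of_isField' h L₀.val e).inf_eq_bot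
    rwa [IntermediateField.fieldRange_val, inf_comm] at h1
  rw [hrange]
  exact fixingSubgroup_sup_eq_top_of_inf_fixedField_eq_bot N E' hdisj

/-! ### The stub -/

/-- **STUB S2 — the residual bundle transports along `res_{K'/K}` for `K'` linearly disjoint from a
control field.**  Let `K` be a number field, `r : Γ_K → GL_n(ℚ̄_ℓ)` framed and
`τ : Γ_K → GL_n(ℤ̄_ℓ/𝔪)` a residual representation of `r` that is absolutely irreducible,
absolutely irreducible on `H = Γ_{K(ζ_ℓ)}` with `τ(H)` enormous, and scalar at some `σ ∉ H`.  Then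
there is a finite extension `L/K` (witness: the fixed field `K̄^{ker τ ∩ H}`) such that for every
number field `K' ⊇ K` with `L ⊗_K K'` a field and `τ' := τ ∘ absGaloisRestrict K K'`,
`H' = Γ_{K'(ζ_ℓ)}`: `τ'` is a residual representation of `r|_{Γ_{K'}}`, `τ'` is absolutely
irreducible and so is `τ'|_{H'}`, `τ'(H') = τ(H)` is enormous, and `τ'(σ')` is scalar for some
`σ' ∉ H'` — all because `res(Γ_{K'}) · (ker τ ∩ H) = Γ_K`
(`range_absGaloisRestrict_sup_eq_top_of_isField`), so that `τ'(Γ_{K'}) = τ(Γ_K)`,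
`τ'(H') = τ(H)` and every `σ ∈ Γ_K` has a representative `σ' ∈ Γ_{K'}` with `τ(res σ') = τ σ`,
`σ' ∈ H' ↔ σ ∈ H` (tree `forall_exists_mem_of_sup_ker_inf_eq_top`,
`mem_absGaloisGroupAdjoinRootsOfUnity_iff_absGaloisRestrict`).  Folklore, used tacitly with every
"`F'` linearly disjoint from `F^{avoid}`" clause. [cite: BarnetlambEtAl2014, §4.5 (role of F^{avoid})]
[cite: ACCGHLNSTT2023, §6.5.12 (proof of Thm. 6.1.1)] -/
theorem stub_residualBundle_restrictField :
    ∀ (K : Type) [Field K] [NumberField K] (n : ℕ) (ℓ : ℕ) [Fact ℓ.Prime]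
      (r : Literature.NumberTheory.GaloisRepresentations.FramedGaloisRep K (PadicAlgCl ℓ) n)
      (τ : Field.absoluteGaloisGroup K →* GL (Fin n) (Literature.NumberTheory.GaloisRepresentations.padicAlgClResidueField ℓ)),
    r.IsResidualRepOf (RingHom.id _) τ →
    Literature.NumberTheory.GaloisRepresentations.IsAbsIrreducible τ →
    Literature.NumberTheory.GaloisRepresentations.IsAbsIrreducible (τ.comp (Literature.NumberTheory.GaloisRepresentations.absGaloisGroupAdjoinRootsOfUnity K ℓ).subtype) →
    Literature.NumberTheory.GaloisRepresentations.Subgroup.IsEnormous ((Literature.NumberTheory.GaloisRepresentations.absGaloisGroupAdjoinRootsOfUnity K ℓ).map τ) →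
    (∃ σ : Field.absoluteGaloisGroup K, σ ∉ (Literature.NumberTheory.GaloisRepresentations.absGaloisGroupAdjoinRootsOfUnity K ℓ) ∧ ∃ c : Literature.NumberTheory.GaloisRepresentations.padicAlgClResidueField ℓ, (τ σ).1 = c • 1) →
    ∃ (L : Type) (_ : Field L) (_ : Algebra K L), FiniteDimensional K L ∧
      ∀ (K' : Type) [Field K'] [NumberField K'] [Algebra K K'], IsField (TensorProduct K L K') →
        (r.restrictField K').IsResidualRepOf (RingHom.id _) (τ.comp (Literature.NumberTheory.GaloisRepresentations.absGaloisRestrict K K').toMonoidHom) ∧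
        Literature.NumberTheory.GaloisRepresentations.IsAbsIrreducible (τ.comp (Literature.NumberTheory.GaloisRepresentations.absGaloisRestrict K K').toMonoidHom) ∧
        Literature.NumberTheory.GaloisRepresentations.IsAbsIrreducible ((τ.comp (Literature.NumberTheory.GaloisRepresentations.absGaloisRestrict K K').toMonoidHom).comp (Literature.NumberTheory.GaloisRepresentations.absGaloisGroupAdjoinRootsOfUnity K' ℓ).subtype) ∧
        Literature.NumberTheory.GaloisRepresentations.Subgroup.IsEnormous ((Literature.NumberTheory.GaloisRepresentations.absGaloisGroupAdjoinRootsOfUnity K' ℓ).map (τ.comp (Literature.NumberTheory.GaloisRepresentations.absGaloisRestrict K K').toMonoidHom)) ∧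
        ∃ σ : Field.absoluteGaloisGroup K', σ ∉ (Literature.NumberTheory.GaloisRepresentations.absGaloisGroupAdjoinRootsOfUnity K' ℓ) ∧
          ∃ c : Literature.NumberTheory.GaloisRepresentations.padicAlgClResidueField ℓ, ((τ.comp (Literature.NumberTheory.GaloisRepresentations.absGaloisRestrict K K').toMonoidHom) σ).1 = c • 1 := by
  intro K _ _ n ℓ _ r τ hres habs habsH hen hσ
  have hℓ : ℓ.Prime := Fact.out
  haveI := normal_absGaloisGroupAdjoinRootsOfUnity K ℓ
  set C : Subgroup (absoluteGaloisGroup K) := absGaloisGroupAdjoinRootsOfUnity K ℓ with hC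
  have hCopen : IsOpen (C : Set (absoluteGaloisGroup K)) :=
    isOpen_absGaloisGroupAdjoinRootsOfUnity K ℓ hℓ.pos
  have hτopen : IsOpen (τ.ker : Set (absoluteGaloisGroup K)) :=
    FramedGaloisRep.isOpen_ker_of_isResidualRepOf hres
  -- the control field `L = K̄^N`, `N = ker τ ∩ Γ_{K(ζ_ℓ)}`
  set N : Subgroup (absoluteGaloisGroup K) := τ.ker ⊓ C with hN
  have hNopen : IsOpen (N : Set (absoluteGaloisGroup K)) := hτopen.inter hCopen
  set L₀ : IntermediateField K (AlgebraicClosure K) := IntermediateField.fixedField N with hL₀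
  haveI hfd : FiniteDimensional K L₀ := finiteDimensional_fixedField_of_isOpen N hNopen
  refine ⟨L₀, inferInstance, inferInstance, hfd, ?_⟩
  intro K' _ _ _ hfield
  -- `res(Γ_{K'}) · N = Γ_K`
  have htop : ((absGaloisRestrict K K').range : Subgroup (absoluteGaloisGroup K)) ⊔ (τ.ker ⊓ C) =
      ⊤ :=
    range_absGaloisRestrict_sup_eq_top_of_isField N K' hfield
  obtain ⟨key, h1, h2⟩ := forall_exists_mem_of_sup_ker_inf_eq_top τ htop
  set τ' : absoluteGaloisGroup K' →* GL (Fin n) (padicAlgClResidueField ℓ) :=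
    τ.comp (absGaloisRestrict K K').toMonoidHom with hτ'
  -- `Γ_{K'(ζ_ℓ)} = res⁻¹ Γ_{K(ζ_ℓ)}`
  have hCE : ∀ σ' : absoluteGaloisGroup K',
      σ' ∈ absGaloisGroupAdjoinRootsOfUnity K' ℓ ↔ absGaloisRestrict K K' σ' ∈ C := fun σ' =>
    mem_absGaloisGroupAdjoinRootsOfUnity_iff_absGaloisRestrict K K' ℓ σ'
  -- `τ'(Γ_{K'}) = τ(Γ_K)`
  have hrange : τ'.range = τ.range := by
    rw [hτ', MonoidHom.range_comp]
    exact h1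
  -- `τ'(Γ_{K'(ζ_ℓ)}) = τ(Γ_{K(ζ_ℓ)})`
  have hmap : (absGaloisGroupAdjoinRootsOfUnity K' ℓ).map τ' = C.map τ := by
    rw [hτ', ← Subgroup.map_map, ← h2]
    congr 1
    ext g
    constructor
    · rintro ⟨σ', hσ', rfl⟩
      exact ⟨⟨σ', rfl⟩, (hCE σ').mp hσ'⟩
    · rintro ⟨⟨σ', rfl⟩, hg⟩
      exact ⟨σ', (hCE σ').mpr hg, rfl⟩
  -- absolute irreducibility of `τ'`
  have habs' : IsAbsIrreducible τ' := habs.of_range_le hrange.ge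
  refine ⟨FramedGaloisRep.isResidualRepOf_restrictField_of_isAbsIrreducible hres K' habs', habs',
    habsH.of_range_le ?_, ?_, ?_⟩
  · -- `τ(Γ_{K(ζ_ℓ)}) ≤ τ'(Γ_{K'(ζ_ℓ)})`
    rw [MonoidHom.range_comp, MonoidHom.range_comp, Subgroup.range_subtype, Subgroup.range_subtype,
      hmap]
  · -- enormous image: the same subgroup
    rw [hmap]
    exact hen
  · -- a scalar off `Γ_{K'(ζ_ℓ)}`
    obtain ⟨σ, hσC, c, hc⟩ := hσ
    obtain ⟨g, ⟨σ', rfl⟩, heq, heC⟩ := key σ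
    refine ⟨σ', fun h' => hσC (heC.mp ((hCE σ').mp h')), c, ?_⟩
    rw [← hc, ← heq]
    rfl

end Summit.Langlands.Langlands.Theorems.UnramifiedFermatWitness

end
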